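import Mathlib
import HarnessLib
import Summits.HubbardSuperconductivity.HubbardSuperconductivity.Theorems.KLProgrammeKLRegimeSplitTwoLegScaleZeroSizesSep
import Summits.HubbardSuperconductivity.HubbardSuperconductivity.Theorems.KLProgrammeKLRegimeSplitSymInterpAliasing

/-!
# Route `KLProgramme` — ENGINE child 19918, two-leg slot at scale `0`: the symmetrised interpolant REPRODUCES every frame of degree `≤ L/2`
# (`evalM (symInterp L (K∘p)) = evalM K`), so the aliasing sizes of the K-separated scale-`0` closer vanish under a degree guard

Cell `gate-hubbard-kl`, seat p1b (g7).  Memo `SCALE0-TWOLEG-EXPORTS.md` (evidence on 19918): at scale `0` the piece `ℓ₀ = E_μ[ν₀(K) − K∘k_F^K]` subtracts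
the CONTINUUM frame `K` from data that sees `K` only at lattice momenta, so the interpolation error `(I_L − 1)K`, `I_L f := evalM (symInterp L f)`,
enters the (E3a) sizes (`aₖ` of `twoLegPieceFn_eval_zero_tier1_size_le_sep`) and breaks the (E3c) Lipschitz clause for lattice-invisible
perturbations (repair (R-deg): admissible frames of degree `< L/2`).  This file is the supplier under such a guard:

* `eval_symInterp_finset_sum` — value-level linearity over finite sums; with p2 g6's harmonic-level reproduction
  `eval_symInterp_harmonic_comp_latticeMomentum_of_le` (`…SymInterpAliasing`, `I_L(h_{m,n}∘p) = h_{m,n}` for `m, n ≤ L/2`):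
* **`eval_symInterp_latticeValues_of_degree_le`** / `evalM_…` — `I_L(K∘p) = K` for `K.degree ≤ L/2`;
* **`twoLegPieceFn_eval_zero_tier1_size_le_sep_of_degree_le`** — the K-separated scale-`0` tier-1 sizes with `aₖ = 0`.

Proofs only; no definitions; nothing about the model is asserted.  References: BGM 2006 §2.3 (2.17) [cite: BenfattoGiulianiMastropietro2006];
trigonometric interpolation folklore (Zygmund X §1).
-/

noncomputable section

namespace Summit.HubbardSuperconductivity.HubbardSuperconductivity.Theorems.KLRegimeSplit

set_option linter.dupNamespace false -- summit = problem name (single-conjunct summit), D-0017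

open Real Finset Complex
open Literature.MathematicalPhysics.QuantumLattice Literature.Probability.LatticeModels
open Literature.MathematicalPhysics.QuantumLattice.BandSectorCounting
open Summit.HubbardSuperconductivity.HubbardSuperconductivity.Theorems.DispersionFlow
open Summit.HubbardSuperconductivity.HubbardSuperconductivity.Theorems.PerturbedFermiCurve
open Summit.HubbardSuperconductivity.HubbardSuperconductivity.Theorems.KLProgrammeLegKernels
open Summit.HubbardSuperconductivity.HubbardSuperconductivity.Theorems.TwoLegFourier

section Interp

variable (L : ℕ) [NeZero L]

/-! ## §1 Linearity over finite sums -/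

/-- Value-level linearity of the interpolant over a finite sum of data. -/
theorem eval_symInterp_finset_sum {ι : Type*} (s : Finset ι) (g : ι → TorusSite 2 L → ℝ) (p : Fin 2 → ℝ) :
    (symInterp L (fun k => ∑ i ∈ s, g i k)).eval p = ∑ i ∈ s, (symInterp L (g i)).eval p := by
  classical
  induction s using Finset.induction_on with
  | empty => simp only [Finset.sum_empty]; exact eval_symInterp_zero L p
  | insert a s ha ih =>
    simp only [Finset.sum_insert ha]
    rw [eval_symInterp_add L (g a) (fun k => ∑ i ∈ s, g i k), ih]

/-! ## §2 Frames of degree `≤ L/2` are reproduced exactly -/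

/-- **EXACT REPRODUCTION**: for a frame with `K.degree ≤ L/2`, the symmetrised interpolant of its lattice values is the frame itself, at every
continuum momentum: `(symInterp L (k⃗ ↦ K(p_k⃗))).eval p = K(p)`. -/
theorem eval_symInterp_latticeValues_of_degree_le (K : TrigPolyC4v) (hK : K.degree ≤ L / 2) (p : Fin 2 → ℝ) :
    (symInterp L (fun k => K.eval (latticeMomentum L k))).eval p = K.eval p := by
  have hdata : (fun k : TorusSite 2 L => K.eval (latticeMomentum L k)) = fun k =>
      ∑ m ∈ range (K.degree + 1), ∑ n ∈ range (K.degree + 1), K.coeff m n * TrigPolyC4v.harmonic m n (latticeMomentum L k) := by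
    funext k; rw [TrigPolyC4v.eval_def]
  rw [hdata, eval_symInterp_finset_sum, TrigPolyC4v.eval_def]
  refine Finset.sum_congr rfl fun m hm => ?_
  rw [eval_symInterp_finset_sum]
  refine Finset.sum_congr rfl fun n hn => ?_
  have hm' : m ≤ L / 2 := (Nat.lt_succ_iff.mp (mem_range.mp hm)).trans hK
  have hn' : n ≤ L / 2 := (Nat.lt_succ_iff.mp (mem_range.mp hn)).trans hK
  rw [eval_symInterp_const_mul, eval_symInterp_harmonic_comp_latticeMomentum_of_le hm' hn']

/-- The same on `Momentum`: `evalM (symInterp L (K∘p)) = evalM K` for `K.degree ≤ L/2`. -/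
theorem evalM_symInterp_latticeValues_of_degree_le (K : TrigPolyC4v) (hK : K.degree ≤ L / 2) :
    evalM (symInterp L (fun k => K.eval (latticeMomentum L k))) = evalM K := by
  funext q
  simp only [evalM_apply, eval_symInterp_latticeValues_of_degree_le L K hK]

/-- **No aliasing under the degree guard**: every derivative of `evalM (symInterp L (K∘p)) − evalM K` vanishes. -/
theorem iteratedFDeriv_symInterp_latticeValues_sub_eq_zero (K : TrigPolyC4v) (hK : K.degree ≤ L / 2) (k : ℕ) (q : Momentum) :
    iteratedFDeriv ℝ k (fun p : Momentum => evalM (symInterp L (fun q => K.eval (latticeMomentum L q))) p - evalM K p) q = 0 := by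
  have hzero : (fun p : Momentum => evalM (symInterp L (fun q => K.eval (latticeMomentum L q))) p - evalM K p) = fun _ => (0 : ℝ) := by
    funext p
    rw [evalM_symInterp_latticeValues_of_degree_le L K hK, sub_self]
  rw [hzero]
  rcases Nat.eq_zero_or_pos k with rfl | hk
  · ext; simp
  · rw [iteratedFDeriv_const_of_ne (by omega)]; rfl

end Interp

/-! ## §3 The K-separated scale-`0` tier-1 sizes with NO aliasing term -/

variable {L M : ℕ} [NeZero L] [NeZero M]

/-- **(E3a) tier 1 of the scale-`0` piece, counterterm vertex separated, frame of degree `≤ L/2`**: the statement of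
`twoLegPieceFn_eval_zero_tier1_size_le_sep` with `aₖ = 0` — only the sizes `mₖ ≥ ‖Dᵏ evalM (symInterp L (klLocSelfEnergyRe…0 − K∘p))‖`, `k ≤ 2`, remain. -/
theorem twoLegPieceFn_eval_zero_tier1_size_le_sep_of_degree_le {R : RenConsts} (hR : ∀ j, 0 ≤ R.Gfr j) {c : ℝ} (hc : 0 < c)
    (hcle : c ≤ klCurveC3 R) {U : ℝ} (hU : 0 < U) (hUle : U ≤ klCurveU0 R) {β : ℝ} (hβmin : klBetaMin ≤ β)
    (hβc : β ≤ Real.exp (c / U ^ 2)) {μ : ℝ} (hμ : μ ∈ klWindowC) {K : TrigPolyC4v} (hK : FrameOK R U (nScales β) μ K)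
    (hdeg : K.degree ≤ L / 2) {m : ℕ → ℝ}
    (hm : ∀ k ≤ 2, ∀ p : Momentum, ‖iteratedFDeriv ℝ k
      (evalM (symInterp L (fun q => klLocSelfEnergyRe L M β U μ K 0 q - K.eval (latticeMomentum L q)))) p‖ ≤ m k)
    {j : ℕ} (hj : j ≤ 2) {X : ℝ} (hX : ∀ l ≤ j, ∀ x : ℝ, ‖iteratedFDeriv ℝ l salmhoferCutoff x‖ ≤ X) (q : Momentum) :
    ‖iteratedFDeriv ℝ j (onM (klTwoLegPieceFn L M β U μ K.eval 0)) q‖ ≤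
      (if j = 0 then m 0 else 0) +
        (j.factorial : ℝ) ^ 2 * (2 * j.factorial * X * 200 ^ j) *
          (if j = 0 then 2 * m 0 else
            (2 * π + 1) * (m 1 * klCurveD1) + (if j = 2 then m 2 * klCurveD1 ^ 2 + m 1 * klCurveD2 else 0)) *
          (4 + max 1 (((j - 1).factorial : ℝ) / (8 / 5))) ^ j := by
  have h := twoLegPieceFn_eval_zero_tier1_size_le_sep (L := L) (M := M) hR hc hcle hU hUle hβmin hβc hμ hK (m := m) (a := fun _ => 0) hm
    (fun k _ p => by rw [iteratedFDeriv_symInterp_latticeValues_sub_eq_zero L K hdeg k p, norm_zero]) hj hX q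
  simpa only [add_zero] using h

/-! ## §4 BAND-LIMITED frames (appended, p1b g7 05:40Z): the right form of the degree guard

A frame built by `symInterp L` has degree FIELD `L` but its coefficient table is supported in the band `m, n ≤ L/2` (`|x̃ᵢ| ≤ L/2`); so the
guard under which aliasing vanishes is not `K.degree ≤ L/2` but BAND-LIMITATION at `L`:
`∀ m n ≤ K.degree, (L/2 < m ∨ L/2 < n) → K.coeff m n = 0`.  Every `symInterp L` output is band-limited (`symInterp_bandLimited`), `fsub` preserves it
(`fsub_bandLimited`), a frame of degree `≤ L/2` is trivially band-limited, and band-limited frames are reproduced exactly. -/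

section Band

variable (L : ℕ) [NeZero L]

/-- **Exact reproduction of BAND-LIMITED frames**: if `K.coeff m n = 0` whenever `L/2 < m` or `L/2 < n` (inside the degree square), then
`(symInterp L (K∘p)).eval p = K.eval p` at every continuum momentum. -/
theorem eval_symInterp_latticeValues_of_bandLimited (K : TrigPolyC4v)
    (hband : ∀ m n, m ≤ K.degree → n ≤ K.degree → (L / 2 < m ∨ L / 2 < n) → K.coeff m n = 0) (p : Fin 2 → ℝ) :
    (symInterp L (fun k => K.eval (latticeMomentum L k))).eval p = K.eval p := by
  have hdata : (fun k : TorusSite 2 L => K.eval (latticeMomentum L k)) = fun k =>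
      ∑ m ∈ range (K.degree + 1), ∑ n ∈ range (K.degree + 1), K.coeff m n * TrigPolyC4v.harmonic m n (latticeMomentum L k) := by
    funext k; rw [TrigPolyC4v.eval_def]
  rw [hdata, eval_symInterp_finset_sum, TrigPolyC4v.eval_def]
  refine Finset.sum_congr rfl fun m hm => ?_
  rw [eval_symInterp_finset_sum]
  refine Finset.sum_congr rfl fun n hn => ?_
  have hm' : m ≤ K.degree := Nat.lt_succ_iff.mp (mem_range.mp hm)
  have hn' : n ≤ K.degree := Nat.lt_succ_iff.mp (mem_range.mp hn)
  rw [eval_symInterp_const_mul]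
  by_cases hmn : m ≤ L / 2 ∧ n ≤ L / 2
  · rw [eval_symInterp_harmonic_comp_latticeMomentum_of_le hmn.1 hmn.2]
  · have hz : K.coeff m n = 0 := hband m n hm' hn' (by omega)
    rw [hz, zero_mul, zero_mul]

/-- The same on `Momentum`. -/
theorem evalM_symInterp_latticeValues_of_bandLimited (K : TrigPolyC4v)
    (hband : ∀ m n, m ≤ K.degree → n ≤ K.degree → (L / 2 < m ∨ L / 2 < n) → K.coeff m n = 0) :
    evalM (symInterp L (fun k => K.eval (latticeMomentum L k))) = evalM K := by
  funext q
  simp only [evalM_apply, eval_symInterp_latticeValues_of_bandLimited L K hband]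

/-- **No aliasing for band-limited frames**: every derivative of `evalM (symInterp L (K∘p)) − evalM K` vanishes. -/
theorem iteratedFDeriv_symInterp_latticeValues_sub_eq_zero_of_bandLimited (K : TrigPolyC4v)
    (hband : ∀ m n, m ≤ K.degree → n ≤ K.degree → (L / 2 < m ∨ L / 2 < n) → K.coeff m n = 0) (k : ℕ) (q : Momentum) :
    iteratedFDeriv ℝ k (fun p : Momentum => evalM (symInterp L (fun q => K.eval (latticeMomentum L q))) p - evalM K p) q = 0 := by
  have hzero : (fun p : Momentum => evalM (symInterp L (fun q => K.eval (latticeMomentum L q))) p - evalM K p) = fun _ => (0 : ℝ) := by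
    funext p
    rw [evalM_symInterp_latticeValues_of_bandLimited L K hband, sub_self]
  rw [hzero]
  rcases Nat.eq_zero_or_pos k with rfl | hk
  · ext; simp
  · rw [iteratedFDeriv_const_of_ne (by omega)]; rfl

omit [NeZero L] in
/-- A frame of degree `≤ L/2` is band-limited at `L` (vacuously). -/
theorem bandLimited_of_degree_le (K : TrigPolyC4v) (hK : K.degree ≤ L / 2) :
    ∀ m n, m ≤ K.degree → n ≤ K.degree → (L / 2 < m ∨ L / 2 < n) → K.coeff m n = 0 := by
  intro m n hm hn h
  omega

/-- **Every `symInterp L` output is band-limited at `L`**: its table is supported on `(|x̃₀|, |x̃₁|)` with `|x̃ᵢ| ≤ L/2`. -/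
theorem symInterp_bandLimited (f : TorusSite 2 L → ℝ) :
    ∀ m n, m ≤ (symInterp L f).degree → n ≤ (symInterp L f).degree → (L / 2 < m ∨ L / 2 < n) → (symInterp L f).coeff m n = 0 := by
  intro m n _ _ h
  show (∑ x : TorusSite 2 L, if ((x 0).valMinAbs.natAbs = m ∧ (x 1).valMinAbs.natAbs = n) then torusCosCoeff L f x else 0) = 0
  refine Finset.sum_eq_zero fun x _ => if_neg ?_
  rintro ⟨h0, h1⟩
  have hx0 : (x 0).valMinAbs.natAbs ≤ L / 2 := ZMod.natAbs_valMinAbs_le (x 0)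
  have hx1 : (x 1).valMinAbs.natAbs ≤ L / 2 := ZMod.natAbs_valMinAbs_le (x 1)
  omega

omit [NeZero L] in
/-- **`fsub` preserves band-limitation.** -/
theorem fsub_bandLimited {A B : TrigPolyC4v}
    (hA : ∀ m n, m ≤ A.degree → n ≤ A.degree → (L / 2 < m ∨ L / 2 < n) → A.coeff m n = 0)
    (hB : ∀ m n, m ≤ B.degree → n ≤ B.degree → (L / 2 < m ∨ L / 2 < n) → B.coeff m n = 0) :
    ∀ m n, m ≤ (fsub A B).degree → n ≤ (fsub A B).degree → (L / 2 < m ∨ L / 2 < n) → (fsub A B).coeff m n = 0 := by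
  intro m n _ _ h
  show coeffExt A m n - coeffExt B m n = 0
  have hA0 : coeffExt A m n = 0 := by
    unfold coeffExt
    split_ifs with hmn
    · exact hA m n hmn.1 hmn.2 h
    · rfl
  have hB0 : coeffExt B m n = 0 := by
    unfold coeffExt
    split_ifs with hmn
    · exact hB m n hmn.1 hmn.2 h
    · rfl
  rw [hA0, hB0, sub_zero]

end Band

/-- **(E3a) tier 1 of the scale-`0` piece, counterterm vertex separated, BAND-LIMITED frame**: `aₖ = 0`. -/
theorem twoLegPieceFn_eval_zero_tier1_size_le_sep_of_bandLimited {L M : ℕ} [NeZero L] [NeZero M] {R : RenConsts} (hR : ∀ j, 0 ≤ R.Gfr j)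
    {c : ℝ} (hc : 0 < c) (hcle : c ≤ klCurveC3 R) {U : ℝ} (hU : 0 < U) (hUle : U ≤ klCurveU0 R) {β : ℝ} (hβmin : klBetaMin ≤ β)
    (hβc : β ≤ Real.exp (c / U ^ 2)) {μ : ℝ} (hμ : μ ∈ klWindowC) {K : TrigPolyC4v} (hK : FrameOK R U (nScales β) μ K)
    (hband : ∀ m n, m ≤ K.degree → n ≤ K.degree → (L / 2 < m ∨ L / 2 < n) → K.coeff m n = 0) {m : ℕ → ℝ}
    (hm : ∀ k ≤ 2, ∀ p : Momentum, ‖iteratedFDeriv ℝ k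
      (evalM (symInterp L (fun q => klLocSelfEnergyRe L M β U μ K 0 q - K.eval (latticeMomentum L q)))) p‖ ≤ m k)
    {j : ℕ} (hj : j ≤ 2) {X : ℝ} (hX : ∀ l ≤ j, ∀ x : ℝ, ‖iteratedFDeriv ℝ l salmhoferCutoff x‖ ≤ X) (q : Momentum) :
    ‖iteratedFDeriv ℝ j (onM (klTwoLegPieceFn L M β U μ K.eval 0)) q‖ ≤
      (if j = 0 then m 0 else 0) +
        (j.factorial : ℝ) ^ 2 * (2 * j.factorial * X * 200 ^ j) *
          (if j = 0 then 2 * m 0 else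
            (2 * π + 1) * (m 1 * klCurveD1) + (if j = 2 then m 2 * klCurveD1 ^ 2 + m 1 * klCurveD2 else 0)) *
          (4 + max 1 (((j - 1).factorial : ℝ) / (8 / 5))) ^ j := by
  have h := twoLegPieceFn_eval_zero_tier1_size_le_sep (L := L) (M := M) hR hc hcle hU hUle hβmin hβc hμ hK (m := m) (a := fun _ => 0) hm
    (fun k _ p => by rw [iteratedFDeriv_symInterp_latticeValues_sub_eq_zero_of_bandLimited L K hband k p, norm_zero]) hj hX q
  simpa only [add_zero] using h

end Summit.HubbardSuperconductivity.HubbardSuperconductivity.Theorems.KLRegimeSplit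

end
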